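import Summits.ValiantsHypothesis.ValiantsHypothesis.Theorems.TwoProducts.RankThreeAffineToricWronskianCorner

/-!
# Toric Wronskians of monomials, part 3: the FIRST TRUNCATION LAYER at a v-resonance (exact sub-leading coefficient)

For `D = J(·,u)` and monomial columns `X^{e_0..e_{K−1}}` the CORNER `Σe_i + N•v` (`N = Σ_{i<K} i`) of the toric Wronskian at a vertex `v` of
`Newt u` carries `det Vandermonde(β)`, `β_i = u_v det(e_i, v)` (✓ `toricW_corner`, p715762) and DIES exactly at a v-RESONANCE `det(e_{i₀},v) = det(e_{j₀},v)`.
This file and its sequel (`…ToricWronskianLayerDet`) compute the NEXT corner — val-idea-crit-8 g5 #113's «first resonant cell, Wronskian side».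
THIS FILE = the one-column engine and the scalar algebra.  Let `p` be the unique SECOND point of `supp u` in direction `ν` (`v` the unique top,
`p ∈ supp u ∖ {v}` strictly above the rest).  ★ `jac_second_level`: the two-level `J`-step on top of ✓ `IsDomTop`.  ★★ `toricW_column_second`:
`D^{k+1} X^e = β^{k+1} X^{e+(k+1)v} + c_k X^{e+kv+p} + (terms strictly ν-below e+kv+p)` with the SUB-CORNER COEFFICIENT
`c_k = toricWSubCoef β γ μ d δ k = d·S_k + E_k` (`γ = u_v det(p,v)`, `μ = u_p`, `d = det(e,p)`, `δ = det(v,p)`; `c_0 = μd`,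
`c_{k+1} = β^{k+1} μ (d + (k+1)δ) + c_k (β+γ)`); ★ `toricW_gamma_mul_subS`: `γ S_k = μ((β+γ)^{k+1} − β^{k+1})`.
§3 = the scalar data used by the sequel: `toricWBt` (`B = (β_i^k)_{k,i}`), the sub-corner columns `toricWSubVec`/`toricWSubCol`, the `d`-part column
`toricWSVec`, and the resonance algebra at `β_{i₀} = β_{j₀}`: `det(B[col i ← c]) = 0` for `i ∉ {i₀,j₀}` (two equal columns), the `i₀ ↔ j₀` antisymmetry
`det(B[col j₀ ← c]) = −det(B[col i₀ ← c])` (`Matrix.det_permute'`), `sub_{i₀} − sub_{j₀} = (d_{i₀} − d_{j₀})·S` (the `E`-parts cancel), `γ·S = μ·((β+γ)^k − β^k)`,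
and `det(B[col i₀ ← (β_{i₀}+γ)^k]) = det Vandermonde(β[i₀ ↦ β_{i₀}+γ])`.
Numerics (scratch `w20.py`, val-port-4 g5): the resulting closed form (sequel, `toricW_first_layer`) is exact on 280/280 instances, 12 of them merges.
HONEST LABEL: exact engine on the OPEN rung 3-AFF (side ladder, crux `stmt-ValiantsHypothesis-5906` `TwoProducts`); (TW-flag) at depth ≥ 2, `OLMLaw`,
`RankThreeAffineLaw(Exp)`, `TwoProducts`, PCB, `ResidualLawV25` UNMOVED; 0 summit distance; VP ≠ VNP is NOT proved.
`--supports stmt-ValiantsHypothesis-5906 --as helper` (val-port-4 g5; critic of record val-idea-crit-8 g5).  New defs (all with parameters, data not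
Props): `toricWSubS`, `toricWSubE`, `toricWSubCoef`, `toricWSubVec`, `toricWSubCol`, `toricWBt`, `toricWSVec`; no instances, no notation, no named
facts. [folklore]
-/

noncomputable section
set_option linter.dupNamespace false

namespace Summit.ValiantsHypothesis.ValiantsHypothesis.Theorems.TwoProducts.RankTwoJacobian

open scoped BigOperators
open MvPolynomial
open Literature.LinearAlgebra.Matrix (wronskianMatrix wronskian wronskianMatrix_apply wronskian_def)

section TowerKernel
open scoped Classical

/-! ### §1 Weight bookkeeping and two coefficient extractions -/

/-- support weights of a product, strictly bounded if one factor is (cf. ✓ `wt_le_of_mem_support_mul`). [folklore] -/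
theorem wt_lt_of_mem_support_mul {ν : Fin 2 → ℝ} {F G : Poly2} {a b : ℝ}
    (hF : ∀ s ∈ F.support, wt ν s ≤ a) (hG : ∀ s ∈ G.support, wt ν s < b) :
    ∀ s ∈ (F * G).support, wt ν s < a + b := by
  intro s hs
  obtain ⟨x, hx, y, hy, rfl⟩ := Finset.mem_add.mp (MvPolynomial.support_mul F G hs)
  rw [wt_add]; linarith [hF x hx, hG y hy]

/-- `wt ν 0 = 0`. [folklore] -/
theorem wt_zero_expo (ν : Fin 2 → ℝ) : wt ν (0 : Expo) = 0 := by simp [wt]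

/-- support weights of a finite product. [folklore] -/
theorem wt_le_of_mem_support_prod {ι : Type*} (S : Finset ι) {ν : Fin 2 → ℝ} {g : ι → Poly2} {w : ι → ℝ}
    (h : ∀ i ∈ S, ∀ s ∈ (g i).support, wt ν s ≤ w i) :
    ∀ s ∈ (∏ i ∈ S, g i).support, wt ν s ≤ ∑ i ∈ S, w i := by
  induction S using Finset.induction_on with
  | empty =>
    intro s hs
    rw [Finset.prod_empty] at hs
    rw [Finset.sum_empty, Finset.mem_singleton.mp ((show (1 : Poly2).support ⊆ {0} by
      rw [← C_1, C_apply]; exact support_monomial_subset) hs), wt_zero_expo]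
  | insert a S ha ih =>
    intro s hs
    rw [Finset.prod_insert ha] at hs
    rw [Finset.sum_insert ha]
    exact wt_le_of_mem_support_mul ν _ _ _ _ (h a (Finset.mem_insert_self a S))
      (ih fun i hi => h i (Finset.mem_insert_of_mem hi)) s hs

/-- a point heavier than (or as heavy as a strict bound on) the whole support carries coefficient `0`. [folklore] -/
theorem coeff_eq_zero_of_wt_lt {ν : Fin 2 → ℝ} {F : Poly2} {Z : Expo} (h : ∀ s ∈ F.support, wt ν s < wt ν Z) :
    coeff Z F = 0 := by
  by_contra hne
  exact lt_irrefl _ (h Z (MvPolynomial.mem_support_iff.mpr hne))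

/-- the support of `±F`. [folklore] -/
theorem support_units_smul_subset (w : ℤˣ) (F : Poly2) : (w • F).support ⊆ F.support := by
  rcases Int.units_eq_one_or w with h | h
  · subst h; rw [one_smul]
  · subst h; rw [Units.neg_smul, one_smul, MvPolynomial.support_neg]

/-- `coeff_{Z} (±F) = ± coeff_Z F`. [folklore] -/
theorem coeff_units_smul (w : ℤˣ) (F : Poly2) (Z : Expo) : coeff Z (w • F) = w • coeff Z F := by
  rcases Int.units_eq_one_or w with h | h
  · subst h; rw [one_smul, one_smul]
  · subst h; rw [Units.neg_smul, one_smul, Units.neg_smul, one_smul, coeff_neg]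

/-- ★ coefficients of `J(X^γ, u)`: `coeff_{γ+s} J(c·X^γ, u) = c · u_s · det(γ, s)`. [folklore] -/
theorem coeff_jac_monomial (u : Poly2) (γ s₀ : Expo) (c : ℂ) :
    coeff (γ + s₀) (jac (monomial γ c) u) = c * coeff s₀ u * ((idet γ s₀ : ℤ) : ℂ) := by
  rw [toricW_jac_monomial, rayEps, Finset.mul_sum, coeff_sum]
  simp_rw [monomial_mul, coeff_monomial, add_right_inj]
  rw [Finset.sum_ite_eq']
  by_cases h : s₀ ∈ u.support
  · rw [if_pos h]; ring
  · rw [if_neg h, MvPolynomial.notMem_support_iff.mp h]; ring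

/-- support of `J(X^γ, u)` lies in `γ + supp u`. [folklore] -/
theorem mem_support_jac_monomial {u : Poly2} {γ : Expo} {c : ℂ} {z : Expo} (hz : z ∈ (jac (monomial γ c) u).support) :
    ∃ s ∈ u.support, z = γ + s := by
  obtain ⟨a, ha, b, hb, rfl⟩ := Finset.mem_add.mp (support_jac_subset _ u hz)
  exact ⟨b, hb, by rw [Finset.mem_singleton.mp (support_monomial_subset ha)]⟩

/-- `det(e + n•v, p) = det(e, p) + n·det(v, p)`. [folklore] -/
theorem idet_add_nsmul_left (e v p : Expo) (n : ℕ) : idet (e + n • v) p = idet e p + (n : ℤ) * idet v p := by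
  unfold idet
  simp only [Finsupp.add_apply, Finsupp.smul_apply, smul_eq_mul]
  push_cast
  ring

/-! ### §2 The second level of one column: `D^{k+1} X^e` at `e + k•v + p` -/

/-- the `d`-part of the sub-corner coefficient: `S 0 = μ`, `S (k+1) = β^{k+1} μ + S k (β + γ)`. [folklore] -/
def toricWSubS (β γ μ : ℂ) : ℕ → ℂ
  | 0 => μ
  | k + 1 => β ^ (k + 1) * μ + toricWSubS β γ μ k * (β + γ)

/-- the `d`-free part: `E 0 = 0`, `E (k+1) = β^{k+1} μ (k+1) δ + E k (β + γ)`. [folklore] -/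
def toricWSubE (β γ μ δ : ℂ) : ℕ → ℂ
  | 0 => 0
  | k + 1 => β ^ (k + 1) * μ * ((k + 1 : ℕ) : ℂ) * δ + toricWSubE β γ μ δ k * (β + γ)

/-- the SUB-CORNER COEFFICIENT of `D^{k+1} X^e` (`β = u_v det(e,v)`, `γ = u_v det(p,v)`, `μ = u_p`, `d = det(e,p)`, `δ = det(v,p)`):
`c k = d · S k + E k`; it satisfies `c 0 = μ d`, `c (k+1) = β^{k+1} μ (d + (k+1)δ) + c k (β + γ)`. [folklore] -/
def toricWSubCoef (β γ μ d δ : ℂ) (k : ℕ) : ℂ := d * toricWSubS β γ μ k + toricWSubE β γ μ δ k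

/-- the recursion of the sub-corner coefficient. [folklore] -/
theorem toricWSubCoef_succ (β γ μ d δ : ℂ) (k : ℕ) :
    toricWSubCoef β γ μ d δ (k + 1) = β ^ (k + 1) * μ * (d + ((k + 1 : ℕ) : ℂ) * δ) + toricWSubCoef β γ μ d δ k * (β + γ) := by
  unfold toricWSubCoef
  show d * (β ^ (k + 1) * μ + toricWSubS β γ μ k * (β + γ)) +
      (β ^ (k + 1) * μ * ((k + 1 : ℕ) : ℂ) * δ + toricWSubE β γ μ δ k * (β + γ)) = _
  ring

/-- `c 0 = μ·d`. [folklore] -/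
theorem toricWSubCoef_zero (β γ μ d δ : ℂ) : toricWSubCoef β γ μ d δ 0 = μ * d := by
  unfold toricWSubCoef; show d * μ + 0 = μ * d; ring

/-- ★ the geometric sum: `γ · S k = μ · ((β+γ)^{k+1} − β^{k+1})`. [folklore] -/
theorem toricW_gamma_mul_subS (β γ μ : ℂ) : ∀ k : ℕ, γ * toricWSubS β γ μ k = μ * ((β + γ) ^ (k + 1) - β ^ (k + 1))
  | 0 => by show γ * μ = _; ring
  | k + 1 => by
    show γ * (β ^ (k + 1) * μ + toricWSubS β γ μ k * (β + γ)) = _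
    have ih := toricW_gamma_mul_subS β γ μ k
    calc γ * (β ^ (k + 1) * μ + toricWSubS β γ μ k * (β + γ))
        = γ * β ^ (k + 1) * μ + (γ * toricWSubS β γ μ k) * (β + γ) := by ring
      _ = γ * β ^ (k + 1) * μ + μ * ((β + γ) ^ (k + 1) - β ^ (k + 1)) * (β + γ) := by rw [ih]
      _ = μ * ((β + γ) ^ (k + 1 + 1) - β ^ (k + 1 + 1)) := by ring

/-- ★ THE TWO-LEVEL J-STEP: if `F` is `ν`-dominated by `P`, its only possible support point of the next level is `Q` (everything else is
strictly below `Q`), `v` is the unique `ν`-top of `u`, `p ∈ supp u ∖ {v}` dominates the rest of `supp u`, and `Q + v = P + p`, then `J(F,u)` has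
the same shape one step up, with sub-corner coefficient `F_P·u_p·det(P,p) + F_Q·u_v·det(Q,v)`. -/
theorem jac_second_level {ν : Fin 2 → ℝ} {F u : Poly2} {P Q v p : Expo} (hv : IsUniqueTop ν u v) (hp : p ∈ u.support) (hpv : p ≠ v)
    (hp2 : ∀ s ∈ u.support, s ≠ v → s ≠ p → wt ν s < wt ν p)
    (hF : IsDomTop ν F P) (hF2 : ∀ s ∈ F.support, s ≠ P → s ≠ Q → wt ν s < wt ν Q) (hPQ : Q + v = P + p) :
    (∀ s ∈ (jac F u).support, s ≠ P + v → s ≠ Q + v → wt ν s < wt ν (Q + v)) ∧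
      coeff (Q + v) (jac F u) =
        coeff P F * coeff p u * ((idet P p : ℤ) : ℂ) + coeff Q F * coeff v u * ((idet Q v : ℤ) : ℂ) := by
  have hwQ : wt ν Q + wt ν v = wt ν P + wt ν p := by rw [← wt_add, ← wt_add, hPQ]
  have hpv' : wt ν p < wt ν v := hv.2 p hp hpv
  have hPQne : P ≠ Q := by intro h; rw [h] at hwQ; linarith
  refine ⟨?_, ?_⟩
  · intro s hs h1 h2
    obtain ⟨a, ha, b, hb, rfl⟩ := Finset.mem_add.mp (support_jac_subset F u hs)
    rw [wt_add, wt_add]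
    by_cases haP : a = P
    · subst haP
      have hbv : b ≠ v := fun h => h1 (by rw [h])
      have hbp : b ≠ p := fun h => h2 (by rw [h, hPQ])
      have := hp2 b hb hbv hbp
      linarith
    · by_cases haQ : a = Q
      · subst haQ
        have hbv : b ≠ v := fun h => h2 (by rw [h])
        have := hv.2 b hb hbv
        linarith
      · have := hF2 a ha haP haQ
        have := hv.le b hb
        linarith
  · set R : Poly2 := F - monomial P (coeff P F) - monomial Q (coeff Q F) with hR
    have hFdec : F = R + monomial P (coeff P F) + monomial Q (coeff Q F) := by rw [hR]; ring
    have hRsupp : ∀ s ∈ R.support, wt ν s < wt ν Q := by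
      intro s hs
      have hsR := MvPolynomial.mem_support_iff.mp hs
      have hc : coeff s R = coeff s F - (if P = s then coeff P F else 0) - (if Q = s then coeff Q F else 0) := by
        rw [hR, coeff_sub, coeff_sub, coeff_monomial, coeff_monomial]
      by_cases h1 : s = P
      · subst h1
        rw [if_pos rfl, if_neg (Ne.symm hPQne), sub_zero, sub_self] at hc
        exact absurd hc hsR
      · by_cases h2 : s = Q
        · subst h2
          rw [if_neg hPQne, if_pos rfl, sub_zero, sub_self] at hc
          exact absurd hc hsR
        · rw [if_neg (Ne.symm h1), if_neg (Ne.symm h2), sub_zero, sub_zero] at hc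
          exact hF2 s (MvPolynomial.mem_support_iff.mpr (hc ▸ hsR)) h1 h2
    have h0 : coeff (Q + v) (jac R u) = 0 := coeff_eq_zero_of_wt_lt fun z hz => by
      obtain ⟨a, ha, b, hb, rfl⟩ := Finset.mem_add.mp (support_jac_subset R u hz)
      rw [wt_add, wt_add]
      have := hRsupp a ha; have := hv.le b hb
      linarith
    have h1 : coeff (Q + v) (jac (monomial P (coeff P F)) u) = coeff P F * coeff p u * ((idet P p : ℤ) : ℂ) := by
      rw [hPQ]; exact coeff_jac_monomial u P p _
    have h2 : coeff (Q + v) (jac (monomial Q (coeff Q F)) u) = coeff Q F * coeff v u * ((idet Q v : ℤ) : ℂ) :=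
      coeff_jac_monomial u Q v _
    have hJ : jac F u = jac R u + jac (monomial P (coeff P F)) u + jac (monomial Q (coeff Q F)) u := by
      conv_lhs => rw [hFdec]
      rw [jac_add_left, jac_add_left]
    rw [hJ, coeff_add, coeff_add, h0, h1, h2, zero_add]

/-- ★★ **THE SECOND LEVEL OF A COLUMN:** with `β = u_v det(e,v)`, `γ = u_v det(p,v)`, `μ = u_p`, `d = det(e,p)`, `δ = det(v,p)`:
every support point of `D^{k+1} X^e` other than the corner `e + (k+1)•v` and the sub-corner `e + k•v + p` is strictly `ν`-below the sub-corner,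
and the sub-corner coefficient is `toricWSubCoef β γ μ d δ k` (`= μd`, then `c(k+1) = β^{k+1} μ (d + (k+1)δ) + c(k)(β+γ)`). -/
theorem toricW_column_second {ν : Fin 2 → ℝ} {u : Poly2} {v p : Expo} (hv : IsUniqueTop ν u v) (hp : p ∈ u.support) (hpv : p ≠ v)
    (hp2 : ∀ s ∈ u.support, s ≠ v → s ≠ p → wt ν s < wt ν p) (e : Expo) :
    ∀ k : ℕ, (∀ s ∈ ((⇑(jacDer u))^[k + 1] (monomial e (1 : ℂ))).support, s ≠ e + (k + 1) • v → s ≠ e + k • v + p →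
        wt ν s < wt ν (e + k • v + p)) ∧
      coeff (e + k • v + p) ((⇑(jacDer u))^[k + 1] (monomial e (1 : ℂ))) =
        toricWSubCoef (coeff v u * ((idet e v : ℤ) : ℂ)) (coeff v u * ((idet p v : ℤ) : ℂ)) (coeff p u)
          ((idet e p : ℤ) : ℂ) ((idet v p : ℤ) : ℂ) k
  | 0 => by
    rw [Function.iterate_one, jacDer_apply, zero_smul, add_zero, zero_add, one_smul, toricWSubCoef_zero]
    refine ⟨fun s hs h1 h2 => ?_, ?_⟩
    · obtain ⟨b, hb, rfl⟩ := mem_support_jac_monomial hs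
      have hbv : b ≠ v := fun h => h1 (by rw [h])
      have hbp : b ≠ p := fun h => h2 (by rw [h])
      rw [wt_add, wt_add]
      linarith [hp2 b hb hbv hbp]
    · rw [coeff_jac_monomial, one_mul]
  | k + 1 => by
    obtain ⟨ih1, ih2⟩ := toricW_column_second hv hp hpv hp2 e k
    have hdom := (isDomTop_iterate_jacDer hv e 1 (k + 1)).1
    have hcor := (isDomTop_iterate_jacDer hv e 1 (k + 1)).2
    rw [Function.iterate_succ_apply', jacDer_apply]
    have hPQ : e + k • v + p + v = e + (k + 1) • v + p := by rw [succ_nsmul]; abel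
    obtain ⟨h1, h2⟩ := jac_second_level hv hp hpv hp2 hdom ih1 hPQ
    have he1 : e + (k + 1) • v + v = e + (k + 1 + 1) • v := by rw [succ_nsmul _ (k + 1), add_assoc]
    rw [hPQ] at h1 h2
    rw [he1] at h1
    refine ⟨h1, ?_⟩
    rw [h2, ih2, hcor, one_mul, idet_add_nsmul_left, toricW_idet_add, idet_add_nsmul_self, toricWSubCoef_succ]
    push_cast
    ring

/-! ### §3 The scalar data of the first layer: `B = (β_i^k)`, the sub-corner columns, and the resonance algebra -/

/-- the SUB-CORNER column of scalars for column `i`: `0` in row `0`, `toricWSubCoef … (k−1)` in row `k ≥ 1`. [folklore] -/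
def toricWSubVec (u : Poly2) (v p : Expo) {K : ℕ} (e : Fin K → Expo) (i : Fin K) (k : Fin K) : ℂ :=
  match (k : ℕ) with
  | 0 => 0
  | k' + 1 => toricWSubCoef (toricWCornerWt u v e i) (coeff v u * ((idet p v : ℤ) : ℂ)) (coeff p u)
      ((idet (e i) p : ℤ) : ℂ) ((idet v p : ℤ) : ℂ) k'

/-- the sub-corner column of MONOMIALS for column `i`. [folklore] -/
def toricWSubCol (u : Poly2) (v p : Expo) {K : ℕ} (e : Fin K → Expo) (i : Fin K) (k : Fin K) : Poly2 :=
  match (k : ℕ) with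
  | 0 => 0
  | k' + 1 => monomial (e i + k' • v + p) (toricWSubVec u v p e i k)

/-- unfolding `toricWSubVec` / `toricWSubCol` in row `k` with `(k : ℕ) = k' + 1`. [folklore] -/
theorem toricWSubCol_succ (u : Poly2) (v p : Expo) {K : ℕ} (e : Fin K → Expo) (i k : Fin K) {k' : ℕ} (hk : (k : ℕ) = k' + 1) :
    toricWSubVec u v p e i k = toricWSubCoef (toricWCornerWt u v e i) (coeff v u * ((idet p v : ℤ) : ℂ)) (coeff p u)
      ((idet (e i) p : ℤ) : ℂ) ((idet v p : ℤ) : ℂ) k' ∧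
    toricWSubCol u v p e i k = monomial (e i + k' • v + p) (toricWSubVec u v p e i k) := by
  constructor
  · unfold toricWSubVec; rw [hk]
  · unfold toricWSubCol; rw [hk]

/-- row `0`: both vanish. [folklore] -/
theorem toricWSubCol_zero (u : Poly2) (v p : Expo) {K : ℕ} (e : Fin K → Expo) (i k : Fin K) (hk : (k : ℕ) = 0) :
    toricWSubVec u v p e i k = 0 ∧ toricWSubCol u v p e i k = 0 := by
  constructor
  · unfold toricWSubVec; rw [hk]
  · unfold toricWSubCol; rw [hk]

/-- the transposed Vandermonde `B k i = β_i^k`. [folklore] -/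
def toricWBt (u : Poly2) (v : Expo) {K : ℕ} (e : Fin K → Expo) : Matrix (Fin K) (Fin K) ℂ :=
  Matrix.of fun k i => toricWCornerWt u v e i ^ (k : ℕ)

/-- columns other than the resonant pair contribute nothing: `det(B[col i ← c]) = 0` for `i ∉ {i₀, j₀}` (two equal columns remain). [folklore] -/
theorem toricWBt_det_updateCol_eq_zero (u : Poly2) (v : Expo) {K : ℕ} (e : Fin K → Expo) {i₀ j₀ : Fin K} (hne : i₀ ≠ j₀)
    (hβ : toricWCornerWt u v e i₀ = toricWCornerWt u v e j₀) {i : Fin K} (hi : i ≠ i₀) (hj : i ≠ j₀) (c : Fin K → ℂ) :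
    ((toricWBt u v e).updateCol i c).det = 0 := by
  refine Matrix.det_zero_of_column_eq hne fun k => ?_
  rw [Matrix.updateCol_apply, Matrix.updateCol_apply, if_neg (Ne.symm hi), if_neg (Ne.symm hj)]
  unfold toricWBt; rw [Matrix.of_apply, Matrix.of_apply, hβ]

/-- the `i₀ ↔ j₀` antisymmetry: `det(B[col j₀ ← c]) = −det(B[col i₀ ← c])`. [folklore] -/
theorem toricWBt_det_updateCol_swap (u : Poly2) (v : Expo) {K : ℕ} (e : Fin K → Expo) {i₀ j₀ : Fin K} (hne : i₀ ≠ j₀)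
    (hβ : toricWCornerWt u v e i₀ = toricWCornerWt u v e j₀) (c : Fin K → ℂ) :
    ((toricWBt u v e).updateCol j₀ c).det = -((toricWBt u v e).updateCol i₀ c).det := by
  have hM : (toricWBt u v e).updateCol j₀ c = ((toricWBt u v e).updateCol i₀ c).submatrix id (Equiv.swap i₀ j₀) := by
    ext k i
    rw [Matrix.submatrix_apply, Matrix.updateCol_apply, Matrix.updateCol_apply, id]
    by_cases h1 : i = j₀
    · subst h1; rw [if_pos rfl, Equiv.swap_apply_right, if_pos rfl]
    · rw [if_neg h1]
      by_cases h2 : i = i₀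
      · subst h2
        rw [Equiv.swap_apply_left, if_neg (Ne.symm hne)]
        unfold toricWBt; rw [Matrix.of_apply, Matrix.of_apply, hβ]
      · rw [Equiv.swap_apply_of_ne_of_ne h2 h1, if_neg h2]
  rw [hM, Matrix.det_permute', Equiv.Perm.sign_swap hne]
  simp

/-- the `d`-part column: `0` in row `0`, `toricWSubS β γ μ (k−1)` in row `k ≥ 1`. [folklore] -/
def toricWSVec (β γ μ : ℂ) {K : ℕ} (k : Fin K) : ℂ :=
  match (k : ℕ) with
  | 0 => 0
  | k' + 1 => toricWSubS β γ μ k'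

/-- the two resonant sub-corner columns differ by `(d_{i₀} − d_{j₀}) · S`. [folklore] -/
theorem toricWSubVec_sub (u : Poly2) (v p : Expo) {K : ℕ} (e : Fin K → Expo) {i₀ j₀ : Fin K}
    (hβ : toricWCornerWt u v e i₀ = toricWCornerWt u v e j₀) :
    toricWSubVec u v p e i₀ - toricWSubVec u v p e j₀ =
      (((idet (e i₀) p : ℤ) : ℂ) - ((idet (e j₀) p : ℤ) : ℂ)) •
        toricWSVec (toricWCornerWt u v e i₀) (coeff v u * ((idet p v : ℤ) : ℂ)) (coeff p u) := by
  funext k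
  rw [Pi.sub_apply, Pi.smul_apply, smul_eq_mul]
  rcases Nat.eq_zero_or_eq_succ_pred (k : ℕ) with h0 | hs
  · rw [(toricWSubCol_zero u v p e i₀ k h0).1, (toricWSubCol_zero u v p e j₀ k h0).1]
    unfold toricWSVec; rw [h0]; ring
  · rw [(toricWSubCol_succ u v p e i₀ k hs).1, (toricWSubCol_succ u v p e j₀ k hs).1, ← hβ]
    unfold toricWSVec toricWSubCoef; rw [hs]; simp only [Nat.pred_succ]; ring

/-- `γ • S = μ • ((β+γ)^k − β^k)` as columns. [folklore] -/
theorem toricWSVec_gamma_smul (β γ μ : ℂ) {K : ℕ} :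
    γ • (toricWSVec β γ μ : Fin K → ℂ) = μ • ((fun k : Fin K => (β + γ) ^ (k : ℕ)) - fun k : Fin K => β ^ (k : ℕ)) := by
  funext k
  rw [Pi.smul_apply, Pi.smul_apply, Pi.sub_apply, smul_eq_mul, smul_eq_mul]
  unfold toricWSVec
  rcases Nat.eq_zero_or_eq_succ_pred (k : ℕ) with h0 | hs
  · rw [h0]; ring
  · rw [hs, toricW_gamma_mul_subS]

/-- replacing column `i₀` of `B` by `((β_{i₀}+γ)^k)_k` gives the transposed Vandermonde of `β⁺ = β[i₀ ↦ β_{i₀} + γ]`. [folklore] -/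
theorem toricWBt_updateCol_shift (u : Poly2) (v : Expo) {K : ℕ} (e : Fin K → Expo) (i₀ : Fin K) (γ : ℂ) :
    ((toricWBt u v e).updateCol i₀ (fun k : Fin K => (toricWCornerWt u v e i₀ + γ) ^ (k : ℕ))).det =
      (Matrix.vandermonde (Function.update (toricWCornerWt u v e) i₀ (toricWCornerWt u v e i₀ + γ))).det := by
  rw [← Matrix.det_transpose (Matrix.vandermonde _)]
  congr 1
  ext k i
  rw [Matrix.updateCol_apply, Matrix.transpose_apply, Matrix.vandermonde_apply]
  by_cases h : i = i₀
  · subst h; rw [if_pos rfl, Function.update_self]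
  · rw [if_neg h, Function.update_of_ne h]; unfold toricWBt; rw [Matrix.of_apply]


end TowerKernel

end Summit.ValiantsHypothesis.ValiantsHypothesis.Theorems.TwoProducts.RankTwoJacobian

end
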